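import Summits.PneNP.PneNP.Theses.SzkEntropy
import Summits.PneNP.PneNP.Theorems.SzkEntropyPeaThreeNotInP
import Summits.PneNP.PneNP.Theorems.SzkEntropyPhCollapse
import Literature.Computability.Complexity.PEASigmaTwo

/-!
# PneNP / SzkEntropy — consequences of the target `PeaThreeNotInP` now that `PEA_3 ∈ promise-Σ₂ᵖ`

Route `PneNP/SzkEntropy`, target item stmt-PneNP-10776 (`PeaThreeNotInP`, thesis X: `PEA_3 ∉ PromiseP`).
With the support `PeaMemPH` PROVED in the sharper form
`Literature.Computability.Complexity.PEAHash.PEA_mem_promiseLift_SigmaP_two` (`PEA_d ∈ promiseLift (SigmaP 2)`,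
Literature/Computability/Complexity/PEASigmaTwo.lean), the hypothesis X now has crisp unconditional
consequences inside the tree's own complexity classes (no Clay-model bridge needed):

* `szkEntropy_SigmaP_two_not_subset_P_of_peaThreeNotInP` — X ⟹ `Σ₂ᵖ ⊄ P`;
* `szkEntropy_NP_not_subset_P_of_peaThreeNotInP` — X ⟹ `NP ⊄ P` (through the proved collapse
  `NP ⊆ P → Σ₂ᵖ ⊆ P`, `SigmaP_subset_P_of_NP_subset_P`).

So the open thesis X sits exactly between `Σ₂ᵖ ≠ P` (which it implies) and `SZKP_L ⊄ prP` (to which it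
is equivalent by Dvir–Gutfreund–Rothblum–Vadhan, Thm 1.1/4.7).  SUPPORT lemmas of the item; X itself
remains open.

References: Z. Dvir, D. Gutfreund, G. N. Rothblum, S. Vadhan, ICS 2011 (ECCC TR10-160), Thm 1.1;
M. Sipser, STOC 1983, §V; S. Arora, B. Barak, CUP 2009, Thm 5.4.
-/

namespace Summit.PneNP.PneNP.Theorems

open Literature.Computability.Complexity
open Summit.PneNP.PneNP.Theses.SzkEntropy

/-- **X implies `Σ₂ᵖ ⊄ P`**: if `PEA_3 ∉ PromiseP` then the second level of the polynomial hierarchy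
is not contained in `P` — for `PEA_3 ∈ promiseLift (SigmaP 2)` (`PEAHash.PEA_mem_promiseLift_SigmaP_two`)
and `promiseLift` is monotone. [DvirGutfreundRothblumVadhan2010, Thm 1.1; Sipser1983, §V] -/
theorem szkEntropy_SigmaP_two_not_subset_P_of_peaThreeNotInP (hX : PeaThreeNotInP) :
    ¬ (SigmaP 2 ⊆ Classes.P) := fun h =>
  szkEntropy_peaThreeNotInP_iff.1 hX (promiseLift_mono h (PEAHash.PEA_mem_promiseLift_SigmaP_two 3))

/-- **X implies `NP ⊄ P`** in the tree's classes: `NP ⊆ P` collapses `Σ₂ᵖ` into `P`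
(`SigmaP_subset_P_of_NP_subset_P`), contradicting the previous lemma.
[DvirGutfreundRothblumVadhan2010, Thm 1.1; AroraBarakCC2009, Thm 5.4] -/
theorem szkEntropy_NP_not_subset_P_of_peaThreeNotInP (hX : PeaThreeNotInP) :
    ¬ (Nondeterministic.NP ⊆ Classes.P) := fun h =>
  szkEntropy_SigmaP_two_not_subset_P_of_peaThreeNotInP hX (SigmaP_subset_P_of_NP_subset_P h 2)

end Summit.PneNP.PneNP.Theorems
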